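import Mathlib.Analysis.SpecialFunctions.Integrals.Basic
import Mathlib.Analysis.Calculus.MeanValue
import Literature.Analysis.FunctionSpaces.BesselJPoissonIntegral
import HarnessLib

/-!
# Truncation of the power series of `J₀` and `J₁` with rigorous remainders

`Literature.Analysis.FunctionSpaces.BesselJ` defines `besselJ 0 x = Σ_k T_k(x)` with
`T_k(x) = besselJTerm 0 x k = (−1)^k (x/2)^{2k}/(k!)²` (Watson §2.1 (8); DLMF 10.2.2). For kernel-checked
numerics one needs the series TRUNCATED with an explicit remainder valid at every real argument (not only
where the terms decrease). This file proves, for every real `x` and every `N`,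

* `abs_besselJ_zero_sub_sum_range_le`: `|J₀(x) − Σ_{k<N} T_k(x)| ≤ (x²/4)^N/(N!)²`, i.e. the remainder
  never exceeds the size of the first omitted term (`abs_besselJTerm_zero_eq`); enclosure form
  `besselJ_zero_mem_Icc_sum_range`;
* `abs_besselJ_one_sub_sum_range_le`: `|J₁(x) − Σ_{k<N} T⁽¹⁾_k(x)| ≤ (x²/4)^N |x|/((N!)²(2N+2))`
  `= |T⁽¹⁾_N(x)|` (`abs_besselJTerm_one_eq`), with `T⁽¹⁾_k(x) = (−1)^k (x/2)^{2k+1}/(k!(k+1)!)`;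
  enclosure form `besselJ_one_mem_Icc_sum_range` (same proof with Poisson's integral
  `x∫₀^π cos(x cos θ) sin²θ dθ = πJ₁(x)`, DLMF 10.9.4, and `∫₀^π cos^{2N} sin² = π(2N)!/(4^N N!² (2N+2))`).

The proof is Poisson's integral `J₀(x) = π⁻¹∫₀^π cos(x cos θ) dθ`
(`besselJ_zero_eq_integral_cos_mul_cos`, Andrews–Askey–Roy (4.9.12)), the Lagrange remainder of the
cosine series applied under the integral, and the Wallis integral `∫₀^π cos^{2N}θ dθ = π(2N)!/(4^N (N!)²)`
(`integral_cos_pow_even_eq`). On the way we prove the Lagrange remainders of the sine and cosine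
Maclaurin series (DLMF 4.19.1–4.19.2) at EVERY real point and to all orders,

* `abs_cos_sub_sum_range_le`: `|cos u − Σ_{k<N} (−1)^k u^{2k}/(2k)!| ≤ |u|^{2N}/(2N)!`,
* `abs_sin_sub_sum_range_le`: `|sin u − Σ_{k<N} (−1)^k u^{2k+1}/(2k+1)!| ≤ |u|^{2N+1}/(2N+1)!`

(Mathlib's `Real.cos_bound` / `Real.sin_bound` cover only `|u| ≤ 1` and order two), by induction:
each remainder vanishes at `0` and is a primitive of (minus) the previous one, so the generic
majorant lemma `abs_le_abs_pow_div_factorial_of_hasDerivAt` (from `monotoneOn_of_deriv_nonneg`)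
raises the order by one.

Higher orders follow for `x ≠ 0` from the recurrence `J_n + J_{n+2} = (2(n+1)/x) J_{n+1}`
(`besselJ_recurrence_holds`). Written for the b2b-lace what-if / input-certification lane (leaf BESSEL-QUAD-J0-SERIES: the `J₀` input
of the `κ_d` bracket in `Literature.Probability.FitznerVanDerHofstad2017.SrwAbsCosineDefect`); dimension-free
analysis, no numerical certificate.

## References
* G. N. Watson, *A Treatise on the Theory of Bessel Functions* (2nd ed., 1944), §2.1 (8), §2.11.
* NIST DLMF 10.2.2 (series of `J_ν`), 10.9.1 (Poisson's integral for `J₀`), 10.9.4 (Poisson's integral),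
  4.19.1–4.19.2 (sine and cosine series).
* G. E. Andrews, R. Askey, R. Roy, *Special Functions* (Cambridge, 1999), §4.9 (4.9.12).
-/

noncomputable section

open Set MeasureTheory intervalIntegral Real Nat

namespace Literature.Analysis.FunctionSpaces

/-! ## A derivative-majorant lemma -/

/-- If `f 0 = 0` and `|f'(u)| ≤ uᵐ/m!` for `u ≥ 0`, then `|f(u)| ≤ u^{m+1}/(m+1)!` for `u ≥ 0`
(monotonicity of `u^{m+1}/(m+1)! ∓ f(u)`). [cite: DLMF, 4.19.1–4.19.2] -/
theorem abs_le_pow_div_factorial_of_hasDerivAt_of_nonneg {f f' : ℝ → ℝ} {m : ℕ}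
    (hf : ∀ u, HasDerivAt f (f' u) u) (h0 : f 0 = 0)
    (hb : ∀ u, 0 ≤ u → |f' u| ≤ u ^ m / m !) {u : ℝ} (hu : 0 ≤ u) :
    |f u| ≤ u ^ (m + 1) / (m + 1)! := by
  have hB : ∀ v : ℝ, HasDerivAt (fun v : ℝ => v ^ (m + 1) / (m + 1)!) (v ^ m / m !) v := by
    intro v
    refine ((hasDerivAt_pow (m + 1) v).div_const ((m + 1)! : ℝ)).congr_deriv ?_
    have hm : (0 : ℝ) < m ! := by positivity
    rw [Nat.add_sub_cancel, Nat.factorial_succ]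
    push_cast
    field_simp
  have key : ∀ s : ℝ, |s| = 1 → s * f u ≤ u ^ (m + 1) / (m + 1)! := by
    intro s hs1
    have hd : ∀ v, HasDerivAt (fun v : ℝ => v ^ (m + 1) / (m + 1)! - s * f v)
        ((v ^ m / (m ! : ℝ)) - s * f' v) v := fun v => (hB v).sub ((hf v).const_mul s)
    have hmono : MonotoneOn (fun v : ℝ => v ^ (m + 1) / (m + 1)! - s * f v) (Ici 0) := by
      refine monotoneOn_of_deriv_nonneg (convex_Ici 0) ?_ ?_ ?_
      · exact fun v _ => (hd v).continuousAt.continuousWithinAt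
      · exact fun v _ => (hd v).differentiableAt.differentiableWithinAt
      · intro v hv
        rw [interior_Ici] at hv
        rw [(hd v).deriv]
        have h1 := hb v (le_of_lt hv)
        have h2 : s * f' v ≤ v ^ m / (m ! : ℝ) :=
          calc s * f' v ≤ |s * f' v| := le_abs_self _
            _ = |f' v| := by rw [abs_mul, hs1, one_mul]
            _ ≤ _ := h1
        linarith
    have h3 := hmono (self_mem_Ici (a := (0 : ℝ))) (mem_Ici.mpr hu) hu
    simp only [h0, mul_zero, sub_zero, zero_pow (Nat.succ_ne_zero m), zero_div] at h3
    linarith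
  rw [abs_le]
  constructor
  · have := key (-1) (by simp); linarith
  · have := key 1 (by simp); linarith

/-- Two-sided version on all of `ℝ`: if `f 0 = 0` and `|f'(u)| ≤ |u|ᵐ/m!` everywhere, then
`|f(u)| ≤ |u|^{m+1}/(m+1)!` everywhere. [cite: DLMF, 4.19.1–4.19.2] -/
theorem abs_le_abs_pow_div_factorial_of_hasDerivAt {f f' : ℝ → ℝ} {m : ℕ}
    (hf : ∀ u, HasDerivAt f (f' u) u) (h0 : f 0 = 0)
    (hb : ∀ u, |f' u| ≤ |u| ^ m / m !) (u : ℝ) :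
    |f u| ≤ |u| ^ (m + 1) / (m + 1)! := by
  rcases le_total 0 u with hu | hu
  · rw [abs_of_nonneg hu]
    exact abs_le_pow_div_factorial_of_hasDerivAt_of_nonneg hf h0
      (fun v hv => by simpa only [abs_of_nonneg hv] using hb v) hu
  · have hg : ∀ v, HasDerivAt (fun v => f (-v)) (-f' (-v)) v := by
      intro v
      have h := (hf (-v)).comp v (hasDerivAt_neg v)
      simpa [Function.comp_def] using h
    have h := abs_le_pow_div_factorial_of_hasDerivAt_of_nonneg (m := m) hg (by simp [h0])
      (fun v hv => by
        rw [abs_neg]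
        simpa only [abs_neg, abs_of_nonneg hv] using hb (-v)) (neg_nonneg.mpr hu)
    rw [abs_of_nonpos hu]
    simpa using h

/-! ## Lagrange remainders of the sine and cosine series at every real point -/

/-- For every `N` and every real `u`:
`|cos u − Σ_{k<N} (−1)^k u^{2k}/(2k)!| ≤ |u|^{2N}/(2N)!` and
`|sin u − Σ_{k<N} (−1)^k u^{2k+1}/(2k+1)!| ≤ |u|^{2N+1}/(2N+1)!`
(induction: each remainder is the primitive of the previous one). [cite: DLMF, 4.19.1–4.19.2] -/
theorem abs_cos_sub_sum_le_and_abs_sin_sub_sum_le (N : ℕ) :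
    (∀ u : ℝ, |Real.cos u - ∑ k ∈ Finset.range N, (-1) ^ k * u ^ (2 * k) / (2 * k)!|
        ≤ |u| ^ (2 * N) / (2 * N)!) ∧
    (∀ u : ℝ, |Real.sin u - ∑ k ∈ Finset.range N, (-1) ^ k * u ^ (2 * k + 1) / (2 * k + 1)!|
        ≤ |u| ^ (2 * N + 1) / (2 * N + 1)!) := by
  induction N with
  | zero =>
    refine ⟨fun u => ?_, fun u => ?_⟩
    · simpa using abs_cos_le_one u
    · simpa using abs_sin_le_abs (x := u)
  | succ N ih =>
    obtain ⟨-, ihs⟩ := ih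
    -- the polynomial derivatives
    have hdS : ∀ (M : ℕ) (u : ℝ),
        HasDerivAt (fun u : ℝ => ∑ k ∈ Finset.range M, (-1 : ℝ) ^ k * u ^ (2 * k + 1) / (2 * k + 1)!)
          (∑ k ∈ Finset.range M, (-1 : ℝ) ^ k * u ^ (2 * k) / (2 * k)!) u := by
      intro M u
      have h2 : HasDerivAt (fun u : ℝ => ∑ k ∈ Finset.range M, (-1 : ℝ) ^ k * u ^ (2 * k + 1) / (2 * k + 1)!)
          (∑ k ∈ Finset.range M, (-1 : ℝ) ^ k * (((2 * k + 1 : ℕ) : ℝ) * u ^ (2 * k + 1 - 1)) / (2 * k + 1)!) u :=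
        HasDerivAt.fun_sum fun k _ => ((hasDerivAt_pow (2 * k + 1) u).const_mul _).div_const _
      refine h2.congr_deriv (Eq.symm ?_)
      refine Finset.sum_congr rfl fun k _ => ?_
      have hsub : 2 * k + 1 - 1 = 2 * k := by omega
      have hfac : ((2 * k + 1)! : ℝ) = ((2 * k + 1 : ℕ) : ℝ) * ((2 * k)! : ℝ) := by
        rw [Nat.factorial_succ]; push_cast; ring
      rw [hsub, hfac]
      have h1 : ((2 * k)! : ℝ) ≠ 0 := by positivity
      have h3 : ((2 * k + 1 : ℕ) : ℝ) ≠ 0 := by positivity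
      field_simp
    have hdC : ∀ u : ℝ,
        HasDerivAt (fun u : ℝ => ∑ k ∈ Finset.range (N + 1), (-1 : ℝ) ^ k * u ^ (2 * k) / (2 * k)!)
          (-(∑ k ∈ Finset.range N, (-1 : ℝ) ^ k * u ^ (2 * k + 1) / (2 * k + 1)!)) u := by
      intro u
      have h2 : HasDerivAt (fun u : ℝ => ∑ k ∈ Finset.range (N + 1), (-1 : ℝ) ^ k * u ^ (2 * k) / (2 * k)!)
          (∑ k ∈ Finset.range (N + 1), (-1 : ℝ) ^ k * (((2 * k : ℕ) : ℝ) * u ^ (2 * k - 1)) / (2 * k)!) u :=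
        HasDerivAt.fun_sum fun k _ => ((hasDerivAt_pow (2 * k) u).const_mul _).div_const _
      refine h2.congr_deriv (Eq.symm ?_)
      rw [Finset.sum_range_succ', ← Finset.sum_neg_distrib]
      simp only [mul_zero, Nat.cast_zero, zero_mul, mul_zero, zero_div, add_zero]
      refine Finset.sum_congr rfl fun k _ => ?_
      have hsub : 2 * (k + 1) - 1 = 2 * k + 1 := by omega
      have hfac : ((2 * (k + 1))! : ℝ) = ((2 * (k + 1) : ℕ) : ℝ) * ((2 * k + 1)! : ℝ) := by
        rw [show 2 * (k + 1) = (2 * k + 1) + 1 by ring, Nat.factorial_succ]; push_cast; ring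
      rw [hsub, hfac, pow_succ, pow_succ]
      have h1 : ((2 * k + 1)! : ℝ) ≠ 0 := by positivity
      have h3 : ((2 * (k + 1) : ℕ) : ℝ) ≠ 0 := by positivity
      field_simp
    -- cosine remainder of order N+1 from the sine remainder of order N
    have hc : ∀ u : ℝ, |Real.cos u - ∑ k ∈ Finset.range (N + 1), (-1) ^ k * u ^ (2 * k) / (2 * k)!|
        ≤ |u| ^ (2 * (N + 1)) / (2 * (N + 1))! := by
      have hf : ∀ u, HasDerivAt
          (fun u => Real.cos u - ∑ k ∈ Finset.range (N + 1), (-1 : ℝ) ^ k * u ^ (2 * k) / (2 * k)!)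
          (-(Real.sin u - ∑ k ∈ Finset.range N, (-1 : ℝ) ^ k * u ^ (2 * k + 1) / (2 * k + 1)!)) u := by
        intro u
        exact ((Real.hasDerivAt_cos u).sub (hdC u)).congr_deriv (by ring)
      have h0 : Real.cos 0 - ∑ k ∈ Finset.range (N + 1), (-1 : ℝ) ^ k * (0 : ℝ) ^ (2 * k) / (2 * k)! = 0 := by
        simp [Finset.sum_range_succ']
      have hb : ∀ u, |-(Real.sin u - ∑ k ∈ Finset.range N, (-1 : ℝ) ^ k * u ^ (2 * k + 1) / (2 * k + 1)!)|
          ≤ |u| ^ (2 * N + 1) / (2 * N + 1)! := fun u => by rw [abs_neg]; exact ihs u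
      intro u
      have h := abs_le_abs_pow_div_factorial_of_hasDerivAt hf h0 hb u
      simpa [show 2 * N + 1 + 1 = 2 * (N + 1) by ring] using h
    refine ⟨hc, fun u => ?_⟩
    -- sine remainder of order N+1 from the cosine remainder of order N+1
    have hf : ∀ u, HasDerivAt
        (fun u => Real.sin u - ∑ k ∈ Finset.range (N + 1), (-1 : ℝ) ^ k * u ^ (2 * k + 1) / (2 * k + 1)!)
        (Real.cos u - ∑ k ∈ Finset.range (N + 1), (-1 : ℝ) ^ k * u ^ (2 * k) / (2 * k)!) u :=
      fun u => (Real.hasDerivAt_sin u).sub (hdS (N + 1) u)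
    have h0 : Real.sin 0 - ∑ k ∈ Finset.range (N + 1), (-1 : ℝ) ^ k * (0 : ℝ) ^ (2 * k + 1) / (2 * k + 1)! = 0 := by
      simp
    have h := abs_le_abs_pow_div_factorial_of_hasDerivAt hf h0 hc u
    simpa [show 2 * (N + 1) + 1 = 2 * (N + 1) + 1 by ring] using h

/-- **Cosine series with Lagrange remainder**: `|cos u − Σ_{k<N} (−1)^k u^{2k}/(2k)!| ≤ |u|^{2N}/(2N)!`
for every real `u` and every `N`. [cite: DLMF, 4.19.2] -/
theorem abs_cos_sub_sum_range_le (u : ℝ) (N : ℕ) :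
    |Real.cos u - ∑ k ∈ Finset.range N, (-1) ^ k * u ^ (2 * k) / (2 * k)!| ≤ |u| ^ (2 * N) / (2 * N)! :=
  (abs_cos_sub_sum_le_and_abs_sin_sub_sum_le N).1 u

/-- **Sine series with Lagrange remainder**: `|sin u − Σ_{k<N} (−1)^k u^{2k+1}/(2k+1)!| ≤ |u|^{2N+1}/(2N+1)!`
for every real `u` and every `N`. [cite: DLMF, 4.19.1] -/
theorem abs_sin_sub_sum_range_le (u : ℝ) (N : ℕ) :
    |Real.sin u - ∑ k ∈ Finset.range N, (-1) ^ k * u ^ (2 * k + 1) / (2 * k + 1)!|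
      ≤ |u| ^ (2 * N + 1) / (2 * N + 1)! :=
  (abs_cos_sub_sum_le_and_abs_sin_sub_sum_le N).2 u

/-! ## The `J₀` series: the remainder after `N` terms is at most the first omitted term in size -/

/-- The partial sums of the `J₀` series are Poisson integrals of the cosine Taylor polynomials:
`Σ_{k<N} T⁽⁰⁾_k(x) = π⁻¹ ∫₀^π Σ_{k<N} (−1)^k (x cos θ)^{2k}/(2k)! dθ`. [cite: AndrewsAskeyRoy1999, §4.9 (4.9.12)] -/
theorem sum_range_besselJTerm_zero_eq_integral (x : ℝ) (N : ℕ) :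
    ∑ k ∈ Finset.range N, besselJTerm 0 x k
      = π⁻¹ * ∫ θ in (0 : ℝ)..π, ∑ k ∈ Finset.range N, (-1) ^ k * (x * cos θ) ^ (2 * k) / (2 * k)! := by
  rw [intervalIntegral.integral_finsetSum (fun k _ =>
    (by fun_prop : Continuous fun θ => (-1 : ℝ) ^ k * (x * cos θ) ^ (2 * k) / (2 * k)!).intervalIntegrable _ _)]
  rw [Finset.mul_sum]
  refine Finset.sum_congr rfl fun k _ => ?_
  have h : ∫ θ in (0 : ℝ)..π, (-1 : ℝ) ^ k * (x * cos θ) ^ (2 * k) / (2 * k)!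
      = (-1) ^ k * x ^ (2 * k) / (2 * k)! * ∫ θ in (0 : ℝ)..π, cos θ ^ (2 * k) := by
    rw [← intervalIntegral.integral_const_mul]
    congr 1; funext θ; rw [mul_pow]; ring
  rw [h, integral_cos_pow_even_eq, pi_mul_besselJTerm_zero, ← mul_assoc, inv_mul_cancel₀ pi_ne_zero, one_mul]

/-- **Truncated `J₀` series with a rigorous remainder**: for every real `x` and every `N`,
`|J₀(x) − Σ_{k<N} (−1)^k (x/2)^{2k}/(k!)²| ≤ (x²/4)^N/(N!)²` — the size of the first omitted term —
by Poisson's integral `J₀(x) = π⁻¹∫₀^π cos(x cos θ)dθ`, the Lagrange remainder of the cosine series and the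
Wallis integral `∫₀^π cos^{2N} = π(2N)!/(4^N N!²)`. [cite: DLMF, 10.2.2 and 10.9.1] -/
theorem abs_besselJ_zero_sub_sum_range_le (x : ℝ) (N : ℕ) :
    |besselJ 0 x - ∑ k ∈ Finset.range N, besselJTerm 0 x k| ≤ (x ^ 2 / 4) ^ N / ((N ! : ℝ)) ^ 2 := by
  have hi1 : IntervalIntegrable (fun θ => cos (x * cos θ)) volume (0 : ℝ) π :=
    (by fun_prop : Continuous fun θ => cos (x * cos θ)).intervalIntegrable _ _
  have hi2 : IntervalIntegrable
      (fun θ => ∑ k ∈ Finset.range N, (-1 : ℝ) ^ k * (x * cos θ) ^ (2 * k) / (2 * k)!) volume (0 : ℝ) π :=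
    (continuous_finsetSum _ fun k _ =>
      (by fun_prop : Continuous fun θ => (-1 : ℝ) ^ k * (x * cos θ) ^ (2 * k) / (2 * k)!)).intervalIntegrable _ _
  have hi3 : IntervalIntegrable (fun θ => |x * cos θ| ^ (2 * N) / (2 * N)!) volume (0 : ℝ) π :=
    (by fun_prop : Continuous fun θ => |x * cos θ| ^ (2 * N) / (2 * N)!).intervalIntegrable _ _
  rw [besselJ_zero_eq_integral_cos_mul_cos, sum_range_besselJTerm_zero_eq_integral, ← mul_sub,
    ← intervalIntegral.integral_sub hi1 hi2, abs_mul, abs_of_pos (inv_pos.mpr pi_pos)]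
  calc π⁻¹ * |∫ θ in (0 : ℝ)..π, (cos (x * cos θ)
          - ∑ k ∈ Finset.range N, (-1 : ℝ) ^ k * (x * cos θ) ^ (2 * k) / (2 * k)!)|
      ≤ π⁻¹ * ∫ θ in (0 : ℝ)..π, |x * cos θ| ^ (2 * N) / (2 * N)! := by
        gcongr
        calc |∫ θ in (0 : ℝ)..π, (cos (x * cos θ)
                - ∑ k ∈ Finset.range N, (-1 : ℝ) ^ k * (x * cos θ) ^ (2 * k) / (2 * k)!)|
            ≤ ∫ θ in (0 : ℝ)..π, |cos (x * cos θ)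
                - ∑ k ∈ Finset.range N, (-1 : ℝ) ^ k * (x * cos θ) ^ (2 * k) / (2 * k)!| :=
              intervalIntegral.abs_integral_le_integral_abs pi_pos.le
          _ ≤ ∫ θ in (0 : ℝ)..π, |x * cos θ| ^ (2 * N) / (2 * N)! :=
              intervalIntegral.integral_mono_on pi_pos.le (hi1.sub hi2).abs hi3
                fun θ _ => abs_cos_sub_sum_range_le (x * cos θ) N
    _ = π⁻¹ * (x ^ (2 * N) / (2 * N)! * ∫ θ in (0 : ℝ)..π, cos θ ^ (2 * N)) := by
        congr 1
        rw [← intervalIntegral.integral_const_mul]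
        congr 1; funext θ
        rw [pow_mul, sq_abs, ← pow_mul, mul_pow]
        ring
    _ = (x ^ 2 / 4) ^ N / ((N ! : ℝ)) ^ 2 := by
        rw [integral_cos_pow_even_eq, div_pow, ← pow_mul]
        have h1 : ((2 * N)! : ℝ) ≠ 0 := by positivity
        have h2 : ((N ! : ℝ)) ≠ 0 := by positivity
        field_simp

/-- The remainder bound is the absolute value of the first omitted term:
`(x²/4)^N/(N!)² = |T⁽⁰⁾_N(x)|`. [cite: DLMF, 10.2.2] -/
theorem abs_besselJTerm_zero_eq (x : ℝ) (N : ℕ) :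
    |besselJTerm 0 x N| = (x ^ 2 / 4) ^ N / ((N ! : ℝ)) ^ 2 := by
  rw [besselJTerm, abs_mul, abs_div, abs_pow, abs_neg, abs_one, one_pow, add_zero, add_zero,
    abs_of_pos (by positivity : (0 : ℝ) < N ! * N !), abs_pow, pow_mul, sq_abs, div_pow]
  ring

/-- `|J₀(x) − Σ_{k<N} T_k(x)| ≤ |T_N(x)|`: the remainder never exceeds the first omitted term in size,
at every real argument. [cite: DLMF, 10.2.2 and 10.9.1] -/
theorem abs_besselJ_zero_sub_sum_range_le_abs_besselJTerm (x : ℝ) (N : ℕ) :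
    |besselJ 0 x - ∑ k ∈ Finset.range N, besselJTerm 0 x k| ≤ |besselJTerm 0 x N| := by
  rw [abs_besselJTerm_zero_eq]
  exact abs_besselJ_zero_sub_sum_range_le x N

/-- **Enclosure form**: `Σ_{k<N} T_k(x) − (x²/4)^N/(N!)² ≤ J₀(x) ≤ Σ_{k<N} T_k(x) + (x²/4)^N/(N!)²`.
[cite: DLMF, 10.2.2 and 10.9.1] -/
theorem besselJ_zero_mem_Icc_sum_range (x : ℝ) (N : ℕ) :
    besselJ 0 x ∈ Icc (∑ k ∈ Finset.range N, besselJTerm 0 x k - (x ^ 2 / 4) ^ N / ((N ! : ℝ)) ^ 2)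
      (∑ k ∈ Finset.range N, besselJTerm 0 x k + (x ^ 2 / 4) ^ N / ((N ! : ℝ)) ^ 2) := by
  have h := abs_besselJ_zero_sub_sum_range_le x N
  rw [abs_le] at h
  constructor <;> linarith [h.1, h.2]

/-! ## The `J₁` series: the same statement with the weight `sin²θ` -/

/-- The partial sums of the `J₁` series as weighted Poisson integrals:
`Σ_{k<N} T⁽¹⁾_k(x) = π⁻¹ x ∫₀^π (Σ_{k<N} (−1)^k (x cos θ)^{2k}/(2k)!) sin²θ dθ`. [cite: AndrewsAskeyRoy1999, §4.9 (4.9.12)] -/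
theorem sum_range_besselJTerm_one_eq_integral (x : ℝ) (N : ℕ) :
    ∑ k ∈ Finset.range N, besselJTerm 1 x k
      = π⁻¹ * (x * ∫ θ in (0 : ℝ)..π,
          (∑ k ∈ Finset.range N, (-1) ^ k * (x * cos θ) ^ (2 * k) / (2 * k)!) * sin θ ^ 2) := by
  simp_rw [Finset.sum_mul]
  rw [intervalIntegral.integral_finsetSum (fun k _ =>
    (by fun_prop : Continuous fun θ => (-1 : ℝ) ^ k * (x * cos θ) ^ (2 * k) / (2 * k)! * sin θ ^ 2)
      |>.intervalIntegrable _ _)]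
  rw [Finset.mul_sum, Finset.mul_sum]
  refine Finset.sum_congr rfl fun k _ => ?_
  have h : ∫ θ in (0 : ℝ)..π, (-1 : ℝ) ^ k * (x * cos θ) ^ (2 * k) / (2 * k)! * sin θ ^ 2
      = (-1) ^ k * x ^ (2 * k) / (2 * k)! * ∫ θ in (0 : ℝ)..π, cos θ ^ (2 * k) * sin θ ^ 2 := by
    rw [← intervalIntegral.integral_const_mul]
    congr 1; funext θ; rw [mul_pow]; ring
  rw [h, integral_cos_pow_even_mul_sin_sq_eq, pi_mul_besselJTerm_one, ← mul_assoc,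
    inv_mul_cancel₀ pi_ne_zero, one_mul]

/-- **Truncated `J₁` series with a rigorous remainder**: for every real `x` and every `N`,
`|J₁(x) − Σ_{k<N} (−1)^k (x/2)^{2k+1}/(k!(k+1)!)| ≤ (x²/4)^N |x| / ((N!)² (2N+2))` — again the size of the
first omitted term (`abs_besselJTerm_one_eq`) — by Poisson's integral
`x ∫₀^π cos(x cos θ) sin²θ dθ = π J₁(x)`, the cosine remainder and `∫₀^π cos^{2N} sin² = π(2N)!/(4^N N!² (2N+2))`.
[cite: DLMF, 10.2.2 and 10.9.4] -/
theorem abs_besselJ_one_sub_sum_range_le (x : ℝ) (N : ℕ) :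
    |besselJ 1 x - ∑ k ∈ Finset.range N, besselJTerm 1 x k|
      ≤ (x ^ 2 / 4) ^ N * |x| / (((N ! : ℝ)) ^ 2 * (2 * N + 2)) := by
  have hi1 : IntervalIntegrable (fun θ => cos (x * cos θ) * sin θ ^ 2) volume (0 : ℝ) π :=
    (by fun_prop : Continuous fun θ => cos (x * cos θ) * sin θ ^ 2).intervalIntegrable _ _
  have hi2 : IntervalIntegrable
      (fun θ => (∑ k ∈ Finset.range N, (-1 : ℝ) ^ k * (x * cos θ) ^ (2 * k) / (2 * k)!) * sin θ ^ 2)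
        volume (0 : ℝ) π :=
    ((continuous_finsetSum _ fun k _ =>
      (by fun_prop : Continuous fun θ => (-1 : ℝ) ^ k * (x * cos θ) ^ (2 * k) / (2 * k)!)).mul
        (by fun_prop : Continuous fun θ => sin θ ^ 2)).intervalIntegrable _ _
  have hi3 : IntervalIntegrable (fun θ => |x * cos θ| ^ (2 * N) / (2 * N)! * sin θ ^ 2) volume (0 : ℝ) π :=
    (by fun_prop : Continuous fun θ => |x * cos θ| ^ (2 * N) / (2 * N)! * sin θ ^ 2).intervalIntegrable _ _
  have hJ : besselJ 1 x = π⁻¹ * (x * ∫ θ in (0 : ℝ)..π, cos (x * cos θ) * sin θ ^ 2) := by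
    rw [mul_integral_cos_mul_cos_mul_sin_sq_eq_pi_mul_besselJ_one, ← mul_assoc, inv_mul_cancel₀ pi_ne_zero,
      one_mul]
  rw [hJ, sum_range_besselJTerm_one_eq_integral, ← mul_sub, ← mul_sub,
    ← intervalIntegral.integral_sub hi1 hi2, abs_mul, abs_of_pos (inv_pos.mpr pi_pos), abs_mul]
  have hpt : ∀ θ : ℝ, |cos (x * cos θ) * sin θ ^ 2
        - (∑ k ∈ Finset.range N, (-1 : ℝ) ^ k * (x * cos θ) ^ (2 * k) / (2 * k)!) * sin θ ^ 2|
      ≤ |x * cos θ| ^ (2 * N) / (2 * N)! * sin θ ^ 2 := by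
    intro θ
    rw [← sub_mul, abs_mul, abs_of_nonneg (sq_nonneg (sin θ))]
    exact mul_le_mul_of_nonneg_right (abs_cos_sub_sum_range_le (x * cos θ) N) (sq_nonneg _)
  calc π⁻¹ * (|x| * |∫ θ in (0 : ℝ)..π, (cos (x * cos θ) * sin θ ^ 2
          - (∑ k ∈ Finset.range N, (-1 : ℝ) ^ k * (x * cos θ) ^ (2 * k) / (2 * k)!) * sin θ ^ 2)|)
      ≤ π⁻¹ * (|x| * ∫ θ in (0 : ℝ)..π, |x * cos θ| ^ (2 * N) / (2 * N)! * sin θ ^ 2) := by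
        gcongr
        calc |∫ θ in (0 : ℝ)..π, (cos (x * cos θ) * sin θ ^ 2
                - (∑ k ∈ Finset.range N, (-1 : ℝ) ^ k * (x * cos θ) ^ (2 * k) / (2 * k)!) * sin θ ^ 2)|
            ≤ ∫ θ in (0 : ℝ)..π, |cos (x * cos θ) * sin θ ^ 2
                - (∑ k ∈ Finset.range N, (-1 : ℝ) ^ k * (x * cos θ) ^ (2 * k) / (2 * k)!) * sin θ ^ 2| :=
              intervalIntegral.abs_integral_le_integral_abs pi_pos.le
          _ ≤ ∫ θ in (0 : ℝ)..π, |x * cos θ| ^ (2 * N) / (2 * N)! * sin θ ^ 2 :=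
              intervalIntegral.integral_mono_on pi_pos.le (hi1.sub hi2).abs hi3 fun θ _ => hpt θ
    _ = π⁻¹ * (|x| * (x ^ (2 * N) / (2 * N)! * ∫ θ in (0 : ℝ)..π, cos θ ^ (2 * N) * sin θ ^ 2)) := by
        congr 2
        rw [← intervalIntegral.integral_const_mul]
        congr 1; funext θ
        rw [pow_mul, sq_abs, ← pow_mul, mul_pow]
        ring
    _ = (x ^ 2 / 4) ^ N * |x| / (((N ! : ℝ)) ^ 2 * (2 * N + 2)) := by
        rw [integral_cos_pow_even_mul_sin_sq_eq, div_pow, ← pow_mul]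
        have h1 : ((2 * N)! : ℝ) ≠ 0 := by positivity
        have h2 : ((N ! : ℝ)) ≠ 0 := by positivity
        have h3 : (2 * (N : ℝ) + 2) ≠ 0 := by positivity
        field_simp

/-- The `J₁` remainder bound is the absolute value of the first omitted term:
`(x²/4)^N |x| / ((N!)² (2N+2)) = |T⁽¹⁾_N(x)|`. [cite: DLMF, 10.2.2] -/
theorem abs_besselJTerm_one_eq (x : ℝ) (N : ℕ) :
    |besselJTerm 1 x N| = (x ^ 2 / 4) ^ N * |x| / (((N ! : ℝ)) ^ 2 * (2 * N + 2)) := by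
  rw [besselJTerm, abs_mul, abs_div, abs_pow, abs_neg, abs_one, one_pow,
    abs_of_pos (by positivity : (0 : ℝ) < N ! * (N + 1)!), abs_pow, pow_succ, pow_mul, sq_abs, div_pow,
    abs_div, abs_two]
  have hf : ((N + 1)! : ℝ) = ((N : ℝ) + 1) * N ! := by rw [Nat.factorial_succ]; push_cast; ring
  rw [hf]
  have h2 : ((N ! : ℝ)) ≠ 0 := by positivity
  have h3 : ((N : ℝ) + 1) ≠ 0 := by positivity
  field_simp
  ring

/-- `|J₁(x) − Σ_{k<N} T⁽¹⁾_k(x)| ≤ |T⁽¹⁾_N(x)|` at every real argument. [cite: DLMF, 10.2.2 and 10.9.4] -/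
theorem abs_besselJ_one_sub_sum_range_le_abs_besselJTerm (x : ℝ) (N : ℕ) :
    |besselJ 1 x - ∑ k ∈ Finset.range N, besselJTerm 1 x k| ≤ |besselJTerm 1 x N| := by
  rw [abs_besselJTerm_one_eq]
  exact abs_besselJ_one_sub_sum_range_le x N

/-- **Enclosure form for `J₁`**. [cite: DLMF, 10.2.2 and 10.9.4] -/
theorem besselJ_one_mem_Icc_sum_range (x : ℝ) (N : ℕ) :
    besselJ 1 x ∈ Icc
      (∑ k ∈ Finset.range N, besselJTerm 1 x k - (x ^ 2 / 4) ^ N * |x| / (((N ! : ℝ)) ^ 2 * (2 * N + 2)))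
      (∑ k ∈ Finset.range N, besselJTerm 1 x k + (x ^ 2 / 4) ^ N * |x| / (((N ! : ℝ)) ^ 2 * (2 * N + 2))) := by
  have h := abs_besselJ_one_sub_sum_range_le x N
  rw [abs_le] at h
  constructor <;> linarith [h.1, h.2]

/-! ## Lipschitz continuity of `J₀` and `J₁` (the modulus needed by any certified quadrature of `J`-integrands) -/

/-- `|J₀(x) − J₀(y)| ≤ |x − y|`: `J₀' = −J₁` and `|J₁| ≤ 1`. [cite: DLMF, 10.6.3 and 10.14.1] -/
theorem abs_besselJ_zero_sub_besselJ_zero_le (x y : ℝ) : |besselJ 0 x - besselJ 0 y| ≤ |x - y| := by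
  have hL : LipschitzWith 1 (besselJ 0) := by
    refine lipschitzWith_of_nnnorm_deriv_le (fun z => (hasDerivAt_besselJ_zero_holds z).differentiableAt)
      fun z => ?_
    rw [(hasDerivAt_besselJ_zero_holds z).deriv, ← NNReal.coe_le_coe, coe_nnnorm, Real.norm_eq_abs, abs_neg,
      NNReal.coe_one]
    exact abs_besselJ_one_le_one z
  have h := hL.dist_le_mul x y
  simpa [Real.dist_eq] using h


end Literature.Analysis.FunctionSpaces

end
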